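import Summits.RiemannHypothesis.RiemannHypothesis.Theorems.PfPersistenceM2ProlateWitness
import HarnessLib

/-!
# M2 upper half (3/7): mollification of the discontinuous prolate witness

pub-rhpf cell (M2 seat, generation 3) — part 3 of 7 of the M2 UPPER-HALF packet.  HONEST FRAMING:
long-odds MECHANISM SEARCH; no RH claims.  Everything in this file is PROVED (kernel-checked, RH-free) or an
explicitly named `def … : Prop` taken as an argument; nothing here implies or assumes RH.  The packet's
headline and full ledger are in `PfPersistenceM2UpperLeak.lean` (part 7):
`ProlateLeakL1 A p Λ` (ONE RH-free prolate leak bound, exponent `p`) + two named literature facts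
⇒ `ConnesLawUpperWitnessWith (2p + 1 + δ)` ⇒ `ConnesLawUpperWith (2p + 1 + δ)` ⇒ `ConnesLawUpper`.

This part (PROVED, routine algebra): the transported guess `k₀` is bounded, measurable and compactly
supported but NOT continuous, so the tree's `isWeilTest_weilConv_moll` / `weilMellin_weilConv` (stated for
continuous factors) are re-proved for locally integrable / integrable factors
(`isWeilTest_weilConv_of_locallyIntegrable`, `weilMellin_weilConv_of_integrable`); the mollified witness
`leakWitness λ f0 f4 n = k₀ ⋆ φ_n` is a Weil test function supported in `[−log λ − 1/(n+1), log λ + 1/(n+1)]`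
with `k̂(s) = M_λ(s − ½) · φ̂_n(s)` (`weilMellin_leakWitness`) and, under (H-LEAK-L1), the pointwise zero
bound `norm_weilMellin_leakWitness_le`.
-/

noncomputable section

set_option linter.dupNamespace false  -- the mandated namespace repeats `RiemannHypothesis`

open Complex Filter Set Topology Metric MeasureTheory
open Literature.NumberTheory.LFunctions
open scoped ComplexConjugate Convolution

namespace Summit.RiemannHypothesis.RiemannHypothesis.Theorems.PfPersistenceM2Leak

/-! ## §G Mollification: the routine algebra (PROVED)

The raw witness `k₀` is bounded, measurable and compactly supported but has jumps (at `t = ±log λ` and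
at the points `e^t = λ/n`), so it is not a Weil test function.  Its mollification `k₀ ⋆ φ_n` with the
tree's mollifier `φ_n = WeilContinuous.moll n` (radius `1/(n+1)`) is, and `(k₀ ⋆ φ_n)^ = k̂₀ · φ̂_n`. -/

section Mollify

open WeilContinuous

/-- A bounded measurable function supported in a compact interval is integrable. -/
theorem integrable_of_bdd_of_support {F : ℝ → ℂ} (hF : Measurable F) {a b K : ℝ}
    (hsupp : Function.support F ⊆ Icc a b) (hK : ∀ x ∈ Icc a b, ‖F x‖ ≤ K) : Integrable F := by
  rw [← integrableOn_iff_integrable_of_support_subset hsupp]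
  exact Measure.integrableOn_of_bounded (measure_Icc_lt_top).ne hF.aestronglyMeasurable
    ((ae_restrict_iff' measurableSet_Icc).2 (Eventually.of_forall hK))

/-- `g ⋆ φ_n` is a Weil test function as soon as `g` is locally integrable with compact support. -/
theorem isWeilTest_weilConv_moll' {g : ℝ → ℂ} (hg : LocallyIntegrable g) (hgs : HasCompactSupport g)
    (n : ℕ) : IsWeilTest (weilConv g (moll n)) := by
  rw [weilConv_eq_convolution_real]
  exact ⟨(hasCompactSupport_moll n).contDiff_convolution_right (ContinuousLinearMap.mul ℝ ℂ)
      hg (contDiff_moll n),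
    HasCompactSupport.convolution (L := ContinuousLinearMap.mul ℝ ℂ) hgs (hasCompactSupport_moll n)⟩

/-- **Product formula for integrable factors**: `(g ⋆ h)^(s) = ĝ(s) ĥ(s)` whenever
`g e^{(s−½)·}` and `h e^{(s−½)·}` are integrable (the tree's `weilMellin_weilConv_holds` assumes
continuity; the proof — Fubini via `integral_convolution` — is the same). -/
theorem weilMellin_weilConv_of_integrable {g h : ℝ → ℂ} {s : ℂ}
    (hGi : Integrable fun u : ℝ ↦ g u * cexp ((s - 1 / 2) * u))
    (hHi : Integrable fun u : ℝ ↦ h u * cexp ((s - 1 / 2) * u)) :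
    weilMellin (weilConv g h) s = weilMellin g s * weilMellin h s := by
  set c : ℂ := s - 1 / 2 with hc
  set G : ℝ → ℂ := fun u ↦ g u * cexp (c * u) with hG
  set H : ℝ → ℂ := fun u ↦ h u * cexp (c * u) with hH
  have key : ∀ t : ℝ, weilConv g h t * cexp (c * t) = (G ⋆[ContinuousLinearMap.mul ℂ ℂ] H) t := by
    intro t
    rw [weilConv_apply, convolution_def, ← integral_mul_const]
    congr 1 with u
    simp only [hG, hH, ContinuousLinearMap.mul_apply']
    have he : cexp (c * t) = cexp (c * u) * cexp (c * ((t - u : ℝ) : ℂ)) := by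
      rw [← Complex.exp_add]
      push_cast
      ring_nf
    rw [he]
    ring
  have hL : weilMellin (weilConv g h) s = ∫ t : ℝ, (G ⋆[ContinuousLinearMap.mul ℂ ℂ] H) t := by
    unfold weilMellin
    exact integral_congr_ae (Eventually.of_forall fun t ↦ key t)
  rw [hL, integral_convolution (ContinuousLinearMap.mul ℂ ℂ) hGi hHi, ContinuousLinearMap.mul_apply']
  rfl

/-- The mollified function vanishes `1/(n+1)` beyond the support radius of `g`. -/
theorem weilConv_moll_eq_zero' {g : ℝ → ℂ} {R : ℝ} (hgs : ∀ u : ℝ, R < |u| → g u = 0) {x : ℝ} (n : ℕ)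
    (hx : R + 1 / ((n : ℝ) + 1) < |x|) : weilConv g (moll n) x = 0 := by
  rw [weilConv_apply]
  refine integral_eq_zero_of_ae (Eventually.of_forall fun u ↦ ?_)
  simp only [Pi.zero_apply]
  rcases le_or_gt (bump n).rOut |x - u| with hu | hu
  · rw [moll_eq_zero hu, mul_zero]
  · have h1 : |x - u| < 1 / ((n : ℝ) + 1) := hu
    have h2 : R < |u| := by
      have := abs_sub_abs_le_abs_sub x u
      linarith
    rw [hgs u h2, zero_mul]

/-- Support of the mollified function. -/
theorem tsupport_weilConv_moll_subset {g : ℝ → ℂ} {R : ℝ} (hgs : ∀ u : ℝ, R < |u| → g u = 0) (n : ℕ) :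
    tsupport (weilConv g (moll n)) ⊆ Icc (-(R + 1 / ((n : ℝ) + 1))) (R + 1 / ((n : ℝ) + 1)) := by
  refine closure_minimal (fun t ht ↦ ?_) isClosed_Icc
  rw [mem_Icc, ← abs_le]
  by_contra h
  exact ht (weilConv_moll_eq_zero' hgs n (not_le.1 h))

variable {lam : ℝ} {f0 f4 : ℝ → ℝ}

/-- On the window `[λ⁻¹, λ]` the series `𝓔(h_λ)` is a finite sum (`n u > λ` for `n > λ²`). -/
theorem connesE_prolateGuessH_eq_sum (h0 : IsProlateFunction lam 0 f0) (h4 : IsProlateFunction lam 4 f4)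
    {u : ℝ} (hu : u ∈ Icc (1 / lam) lam) :
    connesE (prolateGuessH lam f0 f4) u =
      Real.sqrt u * ∑ n ∈ Finset.range (⌈lam ^ 2⌉₊), prolateGuessH lam f0 f4 ((n + 1 : ℕ) * u) := by
  have hlam := h0.lam_pos
  obtain ⟨-, hsupp⟩ := prolateGuessH_lipschitz_support h0 h4
  unfold connesE
  congr 1
  refine tsum_eq_sum fun n hn ↦ hsupp _ ?_
  rw [Finset.mem_range, not_lt] at hn
  have hn' : lam ^ 2 ≤ n := (Nat.le_ceil _).trans (by exact_mod_cast hn)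
  have hu1 : 1 / lam ≤ u := hu.1
  have hlu : 1 ≤ lam * u := by
    calc (1 : ℝ) = lam * (1 / lam) := by field_simp
      _ ≤ lam * u := mul_le_mul_of_nonneg_left hu1 hlam.le
  push_cast
  calc lam = lam * 1 := (mul_one _).symm
    _ ≤ lam * (lam * u) := mul_le_mul_of_nonneg_left hlu hlam.le
    _ = lam ^ 2 * u := by ring
    _ ≤ n * u := mul_le_mul_of_nonneg_right hn' (by linarith [one_div_pos.2 hlam])
    _ < (n + 1) * u := by nlinarith [one_div_pos.2 hlam]

/-- `k₀` is measurable. -/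
theorem measurable_leakRaw (h0 : IsProlateFunction lam 0 f0) (h4 : IsProlateFunction lam 4 f4) :
    Measurable (leakRaw lam f0 f4) := by
  classical
  set h := prolateGuessH lam f0 f4 with hh
  set E : ℝ → ℝ := fun u ↦ Real.sqrt u * ∑ n ∈ Finset.range (⌈lam ^ 2⌉₊), h ((n + 1 : ℕ) * u) with hE
  have hmh : Measurable h := measurable_prolateGuessH h0 h4
  have hmE : Measurable E := by
    refine Real.continuous_sqrt.measurable.mul (Finset.measurable_sum _ fun n _ ↦ ?_)
    exact hmh.comp (measurable_const.mul measurable_id)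
  have heq : (Icc (1 / lam) lam).indicator (connesE h) = (Icc (1 / lam) lam).indicator E := by
    funext u
    by_cases hu : u ∈ Icc (1 / lam) lam
    · rw [indicator_of_mem hu, indicator_of_mem hu, hh, connesE_prolateGuessH_eq_sum h0 h4 hu]
    · rw [indicator_of_notMem hu, indicator_of_notMem hu]
  have : leakRaw lam f0 f4 = fun t ↦ (((Icc (1 / lam) lam).indicator E (Real.exp t) : ℝ) : ℂ) := by
    funext t; simp only [leakRaw, ← hh, heq]
  rw [this]
  exact Complex.measurable_ofReal.comp ((hmE.indicator measurableSet_Icc).comp Real.measurable_exp)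

/-- `k₀` is bounded. -/
theorem exists_norm_leakRaw_le (hE : existsUnique_isProlateFunction) (h0 : IsProlateFunction lam 0 f0)
    (h4 : IsProlateFunction lam 4 f4) : ∃ K : ℝ, 0 ≤ K ∧ ∀ t : ℝ, ‖leakRaw lam f0 f4 t‖ ≤ K := by
  have hlam := h0.lam_pos
  obtain ⟨⟨L, hL⟩, hsupp⟩ := prolateGuessH_lipschitz_support h0 h4
  have hint := integral_zero_lam_prolateGuessH_eq_zero' hE h0 h4
  -- a bound `M` of `h_λ` on `[0, λ]`
  obtain ⟨M, hM⟩ := isCompact_Icc.exists_bound_of_continuousOn (hL.continuousOn)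
  have hM' : ∀ t ∈ Icc 0 lam, |prolateGuessH lam f0 f4 t| ≤ M := fun t ht ↦ by
    simpa [Real.norm_eq_abs] using hM t ht
  refine ⟨Real.sqrt lam * (L * lam + M), ?_, fun t ↦ ?_⟩
  · have : 0 ≤ M := (abs_nonneg _).trans (hM' 0 ⟨le_rfl, hlam.le⟩)
    positivity
  unfold leakRaw
  rw [Complex.norm_real, Real.norm_eq_abs]
  by_cases ht : Real.exp t ∈ Icc (1 / lam) lam
  · rw [indicator_of_mem ht]
    refine (abs_connesE_le hlam hL hsupp hM' hint (Real.exp_pos t)).trans ?_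
    have hM0 : 0 ≤ (L : ℝ) * lam + M := by
      have : 0 ≤ M := (abs_nonneg _).trans (hM' 0 ⟨le_rfl, hlam.le⟩)
      positivity
    exact mul_le_mul_of_nonneg_right (Real.sqrt_le_sqrt ht.2) hM0
  · rw [indicator_of_notMem ht, abs_zero]
    have : 0 ≤ M := (abs_nonneg _).trans (hM' 0 ⟨le_rfl, hlam.le⟩)
    positivity

/-- `k₀ · e^{c·}` is integrable for every `c` (bounded, measurable, compact support). -/
theorem integrable_leakRaw_mul_cexp (hE : existsUnique_isProlateFunction) (h0 : IsProlateFunction lam 0 f0)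
    (h4 : IsProlateFunction lam 4 f4) (c : ℂ) :
    Integrable fun t : ℝ ↦ leakRaw lam f0 f4 t * cexp (c * t) := by
  have hlam := h0.lam_pos
  obtain ⟨K, hK0, hK⟩ := exists_norm_leakRaw_le hE h0 h4
  refine integrable_of_bdd_of_support ((measurable_leakRaw h0 h4).mul (by fun_prop))
    (a := -Real.log lam) (b := Real.log lam) (K := K * Real.exp (‖c‖ * Real.log lam)) ?_ ?_
  · intro t ht
    rw [Function.mem_support] at ht
    rw [mem_Icc, ← abs_le]
    by_contra h
    exact ht (by rw [leakRaw_eq_zero hlam f0 f4 (not_le.1 h), zero_mul])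
  · intro t ht
    rw [mem_Icc, ← abs_le] at ht
    rw [norm_mul, Complex.norm_exp]
    refine mul_le_mul (hK t) (Real.exp_le_exp.2 ?_) (Real.exp_pos _).le hK0
    calc (c * (t : ℂ)).re ≤ ‖c * (t : ℂ)‖ := Complex.re_le_norm _
      _ = ‖c‖ * |t| := by rw [norm_mul, Complex.norm_real, Real.norm_eq_abs]
      _ ≤ ‖c‖ * Real.log lam := mul_le_mul_of_nonneg_left ht (norm_nonneg _)

/-- `k₀` is integrable, hence locally integrable. -/
theorem integrable_leakRaw (hE : existsUnique_isProlateFunction) (h0 : IsProlateFunction lam 0 f0)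
    (h4 : IsProlateFunction lam 4 f4) : Integrable (leakRaw lam f0 f4) := by
  simpa using integrable_leakRaw_mul_cexp hE h0 h4 0

/-- **The mollified prolate witness** `k = k₀ ⋆ φ_n`. -/
def leakWitness (lam : ℝ) (f0 f4 : ℝ → ℝ) (n : ℕ) : ℝ → ℂ :=
  weilConv (leakRaw lam f0 f4) (moll n)

/-- `k₀ ⋆ φ_n` is a Weil test function. -/
theorem isWeilTest_leakWitness (hE : existsUnique_isProlateFunction) (h0 : IsProlateFunction lam 0 f0)
    (h4 : IsProlateFunction lam 4 f4) (n : ℕ) : IsWeilTest (leakWitness lam f0 f4 n) :=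
  isWeilTest_weilConv_moll' (integrable_leakRaw hE h0 h4).locallyIntegrable
    (hasCompactSupport_leakRaw h0.lam_pos f0 f4) n

/-- Support of `k₀ ⋆ φ_n`: `⊆ [−(log λ + 1/(n+1)), log λ + 1/(n+1)]`. -/
theorem tsupport_leakWitness_subset (hlam : 0 < lam) (f0 f4 : ℝ → ℝ) (n : ℕ) :
    tsupport (leakWitness lam f0 f4 n) ⊆
      Icc (-(Real.log lam + 1 / ((n : ℝ) + 1))) (Real.log lam + 1 / ((n : ℝ) + 1)) :=
  tsupport_weilConv_moll_subset (fun _ hu ↦ leakRaw_eq_zero hlam f0 f4 hu) n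

/-- **`(k₀ ⋆ φ_n)^(s) = M_λ(s − ½) · φ̂_n(s)`.** -/
theorem weilMellin_leakWitness (hE : existsUnique_isProlateFunction) (h0 : IsProlateFunction lam 0 f0)
    (h4 : IsProlateFunction lam 4 f4) (n : ℕ) (s : ℂ) :
    weilMellin (leakWitness lam f0 f4 n) s =
      prolateGuessMellin lam f0 f4 (s - 1 / 2) * weilMellin (moll n) s := by
  rw [leakWitness, weilMellin_weilConv_of_integrable (integrable_leakRaw_mul_cexp hE h0 h4 _)
      (((continuous_moll n).mul (by fun_prop)).integrable_of_hasCompactSupport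
        (hasCompactSupport_moll n).mul_right),
    weilMellin_leakRaw h0.lam_pos]

/-- At a non-trivial zero: `‖(k₀ ⋆ φ_n)^(ρ)‖ ≤ (A N^p e^{−2πN} / Re ρ) · ‖φ̂_n(ρ)‖` under (H-LEAK-L1). -/
theorem norm_weilMellin_leakWitness_le (hE : existsUnique_isProlateFunction) {A p Λ : ℝ}
    (hL : ProlateLeakL1 A p Λ) {N : ℕ} (hN : Λ ≤ (N : ℝ)) {f0 f4 : ℝ → ℝ}
    (h0 : IsProlateFunction (Real.sqrt N) 0 f0) (h4 : IsProlateFunction (Real.sqrt N) 4 f4) (n : ℕ)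
    {ρ : ℂ} (hρ : ρ ∈ ZetaZeros.riemannZetaNontrivialZeros) :
    ‖weilMellin (leakWitness (Real.sqrt N) f0 f4 n) ρ‖ ≤
      A * (N : ℝ) ^ p * Real.exp (-(2 * Real.pi * N)) / ρ.re * ‖weilMellin (moll n) ρ‖ := by
  rw [weilMellin_leakWitness hE h0 h4, norm_mul, ← weilMellin_leakRaw h0.lam_pos]
  exact mul_le_mul_of_nonneg_right (norm_weilMellin_leakRaw_le hE hL hN h0 h4 hρ) (norm_nonneg _)

end Mollify

end Summit.RiemannHypothesis.RiemannHypothesis.Theorems.PfPersistenceM2Leak
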